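import Summits.QuantumFields.BalabanUV.T4Continuum.Support.B13DomainGeometryTR

/-!
# NE5 ∕ U3, route P2 — the NUMERICAL SIDE CONDITIONS of L03 ∕ L08 on Bałaban's carriers of record, IN CLOSED FORM and JOINTLY
# SATISFIABLE: `K₀(64, 8) = 162⁶⁴ ∕ 81`, the smallness inequality as `(1+s)·A·e^{5σ+64τ}·162⁶⁴ ≤ 9τ`, and one explicit tuple
# `(A, R, τ, σ, s, κ) = (10⁻⁶·162⁻⁶⁴, 400, 1∕64, 2, 0, 1)` at which `kpInflated_b13`, `decayExtract_b13`, `pinBudget_b13` hold AT ONCE for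
# every `R : TwoRuns G`, every pair of activity families and every window (census row O6-n of route P2; skeleton
# `t4/skeletons/NE5-t4-ne5-p2.md` §5 O6, §6 A5)

Cell `pub-balaban`, unit `b2b-balaban-t4-ne5-p2-g17` (T⁴ fan-out NE5 ∕ node U3, PROVER seat P2).  Summits-side bookkeeping over the wiring of
record `B13DomainGeometryTR` (p208152).  HONEST FRAMING: rung (B)+1 of the FINITE-VOLUME T⁴ continuum programme — NOT infinite volume, NOT
a mass gap, NOT the Clay problem, NOT a proof of NE5; spine 0∕9.  HONEST DEPENDENCY (cell line, verbatim): continuum YM on T⁴ ⇐ BetaPertH ∧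
nine spine estimates (0/9 proved); BetaPertH ⇐ (D1) ∧ (D4) ∧ CAP+tail; G-an2-4 gates asym, D1 and NE2/3/4.

WHAT THIS FILE RECORDS (0 sorry; a CENSUS, not an estimate of any manuscript):
* `K₀_four_eq` — the (1.26) constant that the tree's torus geometry PROVES in d = 4 is `K₀(4·2⁴, 2·4) = e^{64·log 162}∕(8+1)² = 162⁶⁴∕81`
  (`TreeLengthCubeSystem.kappa₀_four`); `log_162_le_six`.
* `smallness_iff` — the smallness hypothesis of `kpInflated_b13` ∕ END-B, `(1+s)·A·e^{5σ+64τ}·K₀(64,8)·9 ≤ τ`, is LITERALLY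
  `(1+s)·A·e^{5σ+64τ}·162⁶⁴ ≤ 9τ`; `rate_room_of_le` — the rate room `64·log 162 + σ + 64τ ≤ R` follows from `386 + σ + 64τ ≤ R`.
* `leaves_b13_witness` — at `A = 10⁻⁶·162⁻⁶⁴`, `R = 400`, `τ = 1∕64`, `σ = 2`, `s = 0`, `κ = 1` the three leaves hold simultaneously, for every
  `R : TwoRuns G`, activity families `ρA ρB` and window `W`, with the exponential majorant `m(Z) = A·e^{−400·d(Z)}`: the hypothesis lists of
  route P2's L03 ∕ L08 on Bałaban's carriers are JOINTLY CONSISTENT (non-vacuity ON THE CARRIERS OF RECORD, not on a toy).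
WITNESS OF WEAKNESS (BC5 discipline, numbers not adjectives): with the tree's PRESENT torus constants the (2.38)-shaped majorant must have
amplitude below `9τ·e^{−5σ−64τ}·162⁻⁶⁴ ≤ 162⁻⁶⁴ < 10⁻¹⁴¹` and decay rate above `64·log 162 > 325` per unit tree length.  These thresholds
measure the crude counting constants of `TreeLengthTorusGeometry` ((1.26) proved with κ₀ = 64·log 162 and K₀ GROWING like e^{κ₀}), NOT
[Balaban1988RG2Cluster]'s: the printed (1.26) ∕ Lemma 3 work with O(1) constants, for which the same two inequalities are the ordinary
Kotecký–Preiss smallness `E₀·e^{O(1)}·O(1) ≤ τ`.  Improving κ₀ ∕ K₀ in the torus geometry is a separate (combinatorial) row; nothing here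
depends on the manuscripts under audit.
-/

namespace Summit.QuantumFields.BalabanUV.T4Continuum.B13ActivityRouteNumerics

open Literature.MathematicalPhysics.QuantumFieldTheory.Balaban1983to89
open Literature.MathematicalPhysics.QuantumFieldTheory.Balaban1983to89.T4ActivityRecursion (KPInflated)
open Summit.QuantumFields.BalabanUV.T4Continuum.B13Carriers (TwoRuns)
open Summit.QuantumFields.BalabanUV.T4Continuum.B13DomainGeometryTR (clusterRep footprint kpInflated_b13 decayExtract_b13 pinBudget_b13)

/-! ## §1 The constants in closed form -/

/-- [folklore] `e^{64·log 162} = 162⁶⁴`. -/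
theorem exp_sixtyfour_log : Real.exp (64 * Real.log 162) = (162 : ℝ) ^ 64 := by
  rw [show (64 : ℝ) * Real.log 162 = ((64 : ℕ) : ℝ) * Real.log 162 by norm_num, Real.exp_nat_mul,
    Real.exp_log (by norm_num : (0 : ℝ) < 162)]

/-- [folklore] **THE TREE's (1.26) CONSTANT IN d = 4, IN CLOSED FORM**: `K₀(4·2⁴, 2·4) = 162⁶⁴ ∕ 81`
(`K₀ c₀ Δ = e^{κ₀(c₀,Δ)}∕(Δ+1)²`, `κ₀(64, 8) = 64·log 162` by `TreeLengthCubeSystem.kappa₀_four`). -/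
theorem K₀_four_eq : B12TreeDecay.K₀ (4 * 2 ^ 4) (2 * 4) = (162 : ℝ) ^ 64 / 81 := by
  rw [B12TreeDecay.K₀, TreeLengthCubeSystem.kappa₀_four, exp_sixtyfour_log]
  norm_num

/-- [folklore] `log 162 ≤ 6` (since `162 ≤ e⁶`, from `e > 2.7182818283`). -/
theorem log_162_le_six : Real.log 162 ≤ 6 := by
  have h1 : (2.7182818283 : ℝ) < Real.exp 1 := Real.exp_one_gt_d9
  have h6 : (162 : ℝ) ≤ Real.exp 6 := by
    have hp : (2.7182818283 : ℝ) ^ 6 ≤ Real.exp 1 ^ 6 := by gcongr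
    rw [← Real.exp_nat_mul] at hp
    norm_num at hp
    linarith
  calc Real.log 162 ≤ Real.log (Real.exp 6) := Real.log_le_log (by norm_num) h6
    _ = 6 := Real.log_exp 6

/-- [folklore] `e⁶ ≤ 404` and `e¹¹ ≤ 59875` (from `e < 2.7182818286`). -/
theorem exp_six_le : Real.exp 6 ≤ 404 ∧ Real.exp 11 ≤ 59875 := by
  have h1 : Real.exp 1 < 2.7182818286 := Real.exp_one_lt_d9
  have h0 : 0 ≤ Real.exp 1 := (Real.exp_pos 1).le
  constructor
  · have hp : Real.exp 1 ^ 6 ≤ (2.7182818286 : ℝ) ^ 6 := by gcongr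
    rw [← Real.exp_nat_mul] at hp
    norm_num at hp
    linarith
  · have hp : Real.exp 1 ^ 11 ≤ (2.7182818286 : ℝ) ^ 11 := by gcongr
    rw [← Real.exp_nat_mul] at hp
    norm_num at hp
    linarith

/-! ## §2 The two inequalities of L03 ∕ END-B, rewritten -/

/-- [folklore] **THE SMALLNESS INEQUALITY IN CLOSED FORM**: `(1+s)·A·e^{5σ+64τ}·K₀(64,8)·9 ≤ τ ↔ (1+s)·A·e^{5σ+64τ}·162⁶⁴ ≤ 9τ`. -/
theorem smallness_iff (A τ σ s : ℝ) :
    (1 + s) * A * Real.exp (σ * 5 + τ * 64) * B12TreeDecay.K₀ (4 * 2 ^ 4) (2 * 4) * 9 ≤ τ ↔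
      (1 + s) * A * Real.exp (σ * 5 + τ * 64) * (162 : ℝ) ^ 64 ≤ 9 * τ := by
  rw [K₀_four_eq]
  constructor
  · intro h; nlinarith [h]
  · intro h; nlinarith [h]

/-- [folklore] **A SUFFICIENT RATE ROOM**: `386 + σ + 64τ ≤ R` gives `64·log 162 + σ + 64τ ≤ R` (`64·log 162 ≤ 384`). -/
theorem rate_room_of_le {σ τ R : ℝ} (h : 386 + σ + τ * 64 ≤ R) : 64 * Real.log 162 + σ + τ * 64 ≤ R := by
  have := log_162_le_six
  linarith

/-! ## §3 One explicit tuple at which L03, L08a, L08b hold AT ONCE on Bałaban's carriers of record -/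

section Witness

variable {G : Type} [GaugeGroup G]

/-- [folklore] The census amplitude `A⋆ = 10⁻⁶ · 162⁻⁶⁴` (positive). -/
theorem amp_pos : (0 : ℝ) < 1 / 1000000 / (162 : ℝ) ^ 64 := by positivity

/-- [folklore] The smallness inequality at the census tuple `(A, τ, σ, s) = (10⁻⁶·162⁻⁶⁴, 1∕64, 2, 0)`:
`1 · 10⁻⁶·162⁻⁶⁴ · e^{10+1} · 162⁶⁴∕81 · 9 ≤ 1∕64` (i.e. `e¹¹ ≤ 140 625`). -/
theorem smallness_witness :
    (1 + 0) * (1 / 1000000 / (162 : ℝ) ^ 64) * Real.exp (2 * 5 + 1 / 64 * 64) * B12TreeDecay.K₀ (4 * 2 ^ 4) (2 * 4) * 9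
      ≤ 1 / 64 := by
  rw [K₀_four_eq]
  have h11 := exp_six_le.2
  have hpow : (0 : ℝ) < (162 : ℝ) ^ 64 := by positivity
  rw [show (2 : ℝ) * 5 + 1 / 64 * 64 = 11 by norm_num]
  rw [show (1 + 0) * (1 / 1000000 / (162 : ℝ) ^ 64) * Real.exp 11 * ((162 : ℝ) ^ 64 / 81) * 9
      = Real.exp 11 / 9000000 by field_simp; ring]
  linarith

/-- [folklore] The rate room at the census tuple: `64·log 162 + 2 + (1∕64)·64 ≤ 400`. -/
theorem rate_witness : 64 * Real.log 162 + 2 + 1 / 64 * 64 ≤ 400 :=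
  rate_room_of_le (by norm_num)

/-- [folklore] **JOINT NON-VACUITY OF L03 ∕ L08 ON BAŁABAN's CARRIERS OF RECORD.**  For every `R : TwoRuns G`, all activity families
`ρA ρB`, every window `W`: with the exponential majorant `m(Z) = A⋆·e^{−400·d(Z)}`, `A⋆ = 10⁻⁶·162⁻⁶⁴`, pin rate `τ = 1∕64`, `σ = 2`, `s = 0`,
decay `κ = 1`, the three leaves `kpInflated_b13` (L03), `decayExtract_b13` (L08a), `pinBudget_b13` (L08b) hold SIMULTANEOUSLY — obtained from
the generic theorems, so their hypothesis lists are jointly consistent on the carriers of record.  A census, not an estimate: it says which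
activities the PRESENT constants admit (amplitude < 162⁻⁶⁴), nothing about Bałaban's. -/
theorem leaves_b13_witness (R : TwoRuns G) (ρA ρB : (ℕ → ℝ) → R.carriers.BgB → R.carriers.Dom → ℂ) (W : Set (ℕ → ℝ)) :
    KPInflated (clusterRep R ρA ρB) W
        (fun _ _ Z => 1 / 1000000 / (162 : ℝ) ^ 64 * Real.exp (-(400 * R.carriers.d Z))) 0
        (fun Z => 1 / 64 * ((footprint Z).card : ℝ)) (fun Z => 2 * R.carriers.d Z + 2 * 5) ∧
      (clusterRep R ρA ρB).DecayExtract (fun X => 2 * (R.carriers.d X + 5)) (fun Z => 2 * R.carriers.d Z + 2 * 5) ∧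
      (clusterRep R ρA ρB).PinBudget (fun Z => 1 / 64 * ((footprint Z).card : ℝ)) (fun X => 2 * (R.carriers.d X + 5))
        (1 / 64 * 64 * Real.exp (-(2 * 5))) 1 := by
  refine ⟨?_, decayExtract_b13 ρA ρB (by norm_num), pinBudget_b13 ρA ρB (by norm_num) (by norm_num)⟩
  exact kpInflated_b13 ρA ρB (A := 1 / 1000000 / (162 : ℝ) ^ 64) (Rm := 400) (τ := 1 / 64) (σ := 2) (s := 0)
    amp_pos.le (by norm_num) (by norm_num) le_rfl
    (fun _ _ Z => mul_nonneg amp_pos.le (Real.exp_nonneg _)) (fun _ _ _ _ Z _ => le_rfl) rate_witness smallness_witness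

end Witness

end Summit.QuantumFields.BalabanUV.T4Continuum.B13ActivityRouteNumerics
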